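import Literature.Probability.RandomPlanarGeometry.RadialBesselNonHitting
import Literature.Probability.RandomPlanarGeometry.RadialBesselFlowMeasurable
import HarnessLib

/-!
# A coercive Lyapunov function for the radial Bessel process of SLE_κ, `κ ≤ 4`: uniform moment bound

Topic `Probability/RandomPlanarGeometry`; theorems only, sequel of `RadialBesselNonHitting`. For the
SLE_κ radial Bessel process `dYₜ = cot(Yₜ/2) dt - √κ dBₜ` on `(0, 2π)` (LSW (2002), (2.11); Lawler
(2005), (1.16), (6.13)) with `0 < κ ≤ 4` (non-hitting regime, `RadialBesselNonHitting`), the function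

  `V(y) = (1 - log sin(y/2))^{1/2} ≥ 1`,

`C²` on `(0, 2π)` and tending to `+∞` at both endpoints, satisfies the **coercive Lyapunov
inequality** `Λ₁ V = (κ/2) V'' + cot(·/2) V' + V ≤ C_κ` on `(0, 2π)` with the explicit constant
`C_κ = (40 + κ + 10000/κ)/32` (`expGenerator_sqrtLyap_le`; the point is that
`Λ₀ V ≈ -(κ/32) cot²(y/2) V^{-3}` near the endpoints beats `V ≈ (log(1/sin(y/2)))^{1/2}`, also in
the critical case `κ = 4` — Bessel dimension `2` — where no power of `sin(y/2)` and no multiple of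
`log sin(y/2)` is coercive). By the exponentially weighted generator martingale of `RadialBesselSLE`
(`integral_expClock_mul_eq`, Lawler (2005), Lemma 1.31 pattern) at the level exit times `σₙ` and
Fatou's lemma along `σₙ → T = ∞` (`RadialBesselNonHitting`), this gives the **uniform-in-time moment
bound**

  `E^θ[V(Yₜ)] ≤ e^{-t} V(θ) + C_κ (1 - e^{-t}) ≤ V(θ) + C_κ`   (`lintegral_sqrtLyap_sleArg_le`),

i.e. tightness of the laws `(P^θ[Yₜ ∈ ·])_{t ≥ 0}` inside the open interval `(0, 2π)`, uniformly in
time. This is the positive-recurrence input for the existence of the stationary law of the SLE_κ(ρ)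
angle process (Miller–Sheffield (2017), Prop. 2.1) via the Krylov–Bogoliubov theorem of the tree
(`Process.KrylovBogoliubov`), used in the proof of `IsStationaryAngleLaw.exists_unique`.

## References

* G. F. Lawler, *Conformally Invariant Processes in the Plane*, AMS (2005), §1.11 (eq. (1.16),
  Lemma 1.31). [Lawler2005]
* J. Miller, S. Sheffield, *Imaginary geometry IV*, Probab. Theory Related Fields 169 (2017),
  arXiv:1302.4738, §2.1.2 and Prop. 2.1. [MillerSheffield2013]
* S. P. Meyn, R. L. Tweedie, *Markov Chains and Stochastic Stability* (1993), Ch. 15 (drift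
  condition `ΛV ≤ -λV + C`).
-/

noncomputable section

open MeasureTheory ProbabilityTheory Filter Topology Set
open scoped NNReal ENNReal

namespace Literature.Probability.RandomPlanarGeometry

namespace RadialLoewner

open Literature.Probability.Process Literature.Analysis.FunctionSpaces

variable {κ : ℝ≥0} {n : ℕ} {θ : ℝ}

/-! ### Calculus of `V = (1 - log sin(·/2))^{1/2}` on `(0, 2π)` -/

section Calculus

/-- `1 - log sin(y/2) ≥ 1` everywhere. [folklore] -/
theorem one_le_oneSubLogSinHalf (y : ℝ) : 1 ≤ 1 - Real.log (Real.sin (y / 2)) := by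
  linarith [negLogSinHalf_nonneg y]

/-- `V ≥ 1` everywhere. [folklore] -/
theorem one_le_sqrtLyap (y : ℝ) : 1 ≤ Real.sqrt (1 - Real.log (Real.sin (y / 2))) :=
  Real.one_le_sqrt.2 (one_le_oneSubLogSinHalf y)

/-- `V > 0` everywhere. [folklore] -/
theorem sqrtLyap_pos (y : ℝ) : 0 < Real.sqrt (1 - Real.log (Real.sin (y / 2))) :=
  one_pos.trans_le (one_le_sqrtLyap y)

/-- `V ≥ 0` everywhere. [folklore] -/
theorem sqrtLyap_nonneg (y : ℝ) : 0 ≤ Real.sqrt (1 - Real.log (Real.sin (y / 2))) :=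
  Real.sqrt_nonneg _

/-- `V` is measurable. [folklore] -/
theorem measurable_sqrtLyap : Measurable fun y : ℝ ↦ Real.sqrt (1 - Real.log (Real.sin (y / 2))) :=
  Real.continuous_sqrt.measurable.comp
    (measurable_const.sub (Real.measurable_log.comp (Real.continuous_sin.measurable.comp
      (measurable_id.div_const 2))))

/-- `d/dy (1 - log sin(y/2)) = -(1/2) cot(y/2)` on `(0, 2π)`. [folklore] -/
theorem hasDerivAt_oneSubLogSinHalf {y : ℝ} (hy : y ∈ Ioo 0 (2 * Real.pi)) :
    HasDerivAt (fun y ↦ 1 - Real.log (Real.sin (y / 2))) (-(1 / 2) * Real.cot (y / 2)) y := by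
  have h := (hasDerivAt_negLogSinHalf hy).const_add 1
  have hfun : (fun y ↦ 1 - Real.log (Real.sin (y / 2))) = fun y ↦ 1 + -Real.log (Real.sin (y / 2)) :=
    funext fun y ↦ sub_eq_add_neg _ _
  rw [hfun]
  exact h

/-- `d/dy cot(y/2) = -1/(2 sin²(y/2))` on `(0, 2π)`. [folklore] -/
theorem hasDerivAt_cotHalf {y : ℝ} (hy : y ∈ Ioo 0 (2 * Real.pi)) :
    HasDerivAt (fun y : ℝ ↦ Real.cot (y / 2)) (-(Real.sin (y / 2) ^ 2)⁻¹ * (1 / 2)) y :=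
  HasDerivAt.comp (h₂ := Real.cot) (h := fun z : ℝ ↦ z / 2) y (Real.hasDerivAt_cot (sin_half_pos hy).ne')
    ((hasDerivAt_id' y).div_const 2)

/-- **`V' = -(1/4) cot(y/2) / V`** on `(0, 2π)`. [folklore] -/
theorem hasDerivAt_sqrtLyap {y : ℝ} (hy : y ∈ Ioo 0 (2 * Real.pi)) :
    HasDerivAt (fun y ↦ Real.sqrt (1 - Real.log (Real.sin (y / 2))))
      (-(1 / 4) * Real.cot (y / 2) / Real.sqrt (1 - Real.log (Real.sin (y / 2)))) y := by
  have hw0 : 1 - Real.log (Real.sin (y / 2)) ≠ 0 := by linarith [one_le_oneSubLogSinHalf y]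
  have h := HasDerivAt.comp (h₂ := Real.sqrt) (h := fun y ↦ 1 - Real.log (Real.sin (y / 2))) y
    (Real.hasDerivAt_sqrt hw0) (hasDerivAt_oneSubLogSinHalf hy)
  refine h.congr_deriv ?_
  have hr : Real.sqrt (1 - Real.log (Real.sin (y / 2))) ≠ 0 := (sqrtLyap_pos y).ne'
  field_simp
  ring

/-- **The derivative of `V'`** on `(0, 2π)` (quotient rule), i.e. `V''` in raw form. [folklore] -/
theorem hasDerivAt_deriv_sqrtLyap {y : ℝ} (hy : y ∈ Ioo 0 (2 * Real.pi)) :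
    HasDerivAt (fun y ↦ -(1 / 4) * Real.cot (y / 2) / Real.sqrt (1 - Real.log (Real.sin (y / 2))))
      ((-(1 / 4) * (-(Real.sin (y / 2) ^ 2)⁻¹ * (1 / 2)) * Real.sqrt (1 - Real.log (Real.sin (y / 2))) -
        -(1 / 4) * Real.cot (y / 2) *
          (-(1 / 4) * Real.cot (y / 2) / Real.sqrt (1 - Real.log (Real.sin (y / 2))))) /
        Real.sqrt (1 - Real.log (Real.sin (y / 2))) ^ 2) y :=
  ((hasDerivAt_cotHalf hy).const_mul (-(1 / 4))).div (hasDerivAt_sqrtLyap hy) (sqrtLyap_pos y).ne'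

/-- The first derivative of `V` on `(0, 2π)`. [folklore] -/
theorem deriv_sqrtLyap {y : ℝ} (hy : y ∈ Ioo 0 (2 * Real.pi)) :
    deriv (fun y ↦ Real.sqrt (1 - Real.log (Real.sin (y / 2)))) y =
      -(1 / 4) * Real.cot (y / 2) / Real.sqrt (1 - Real.log (Real.sin (y / 2))) :=
  (hasDerivAt_sqrtLyap hy).deriv

/-- The first derivative of `V` near a point of `(0, 2π)`. [folklore] -/
theorem deriv_sqrtLyap_eventuallyEq {y : ℝ} (hy : y ∈ Ioo 0 (2 * Real.pi)) :
    deriv (fun y ↦ Real.sqrt (1 - Real.log (Real.sin (y / 2)))) =ᶠ[𝓝 y]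
      fun y ↦ -(1 / 4) * Real.cot (y / 2) / Real.sqrt (1 - Real.log (Real.sin (y / 2))) := by
  filter_upwards [Ioo_mem_nhds hy.1 hy.2] with z hz
  exact deriv_sqrtLyap hz

/-- **The second derivative of `V`** on `(0, 2π)`, in raw quotient-rule form. [folklore] -/
theorem iteratedDeriv_two_sqrtLyap {y : ℝ} (hy : y ∈ Ioo 0 (2 * Real.pi)) :
    iteratedDeriv 2 (fun y ↦ Real.sqrt (1 - Real.log (Real.sin (y / 2)))) y =
      (-(1 / 4) * (-(Real.sin (y / 2) ^ 2)⁻¹ * (1 / 2)) * Real.sqrt (1 - Real.log (Real.sin (y / 2))) -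
        -(1 / 4) * Real.cot (y / 2) *
          (-(1 / 4) * Real.cot (y / 2) / Real.sqrt (1 - Real.log (Real.sin (y / 2))))) /
        Real.sqrt (1 - Real.log (Real.sin (y / 2))) ^ 2 := by
  rw [iteratedDeriv_succ, iteratedDeriv_one, (deriv_sqrtLyap_eventuallyEq hy).deriv_eq]
  exact (hasDerivAt_deriv_sqrtLyap hy).deriv

/-- `V` is `C²` on `(0, 2π)`. [folklore] -/
theorem contDiffOn_sqrtLyap :
    ContDiffOn ℝ 2 (fun y ↦ Real.sqrt (1 - Real.log (Real.sin (y / 2)))) (Ioo 0 (2 * Real.pi)) := by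
  intro y hy
  have hs := sin_half_pos hy
  have hw0 : 1 - Real.log (Real.sin (y / 2)) ≠ 0 := by linarith [one_le_oneSubLogSinHalf y]
  have h1 : ContDiffAt ℝ 2 (fun y : ℝ ↦ Real.sin (y / 2)) y :=
    Real.contDiff_sin.contDiffAt.comp y (contDiffAt_id.div_const 2)
  have hlog : ContDiffAt ℝ 2 (Real.log ∘ fun y : ℝ ↦ Real.sin (y / 2)) y :=
    (Real.contDiffAt_log.2 hs.ne').comp y h1
  have h2 : ContDiffAt ℝ 2 (fun y : ℝ ↦ 1 - Real.log (Real.sin (y / 2))) y := contDiffAt_const.sub hlog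
  exact ((Real.contDiffAt_sqrt hw0).comp y h2).contDiffWithinAt

/-- `V` is continuous on `(0, 2π)`. [folklore] -/
theorem continuousOn_sqrtLyap :
    ContinuousOn (fun y ↦ Real.sqrt (1 - Real.log (Real.sin (y / 2)))) (Ioo 0 (2 * Real.pi)) :=
  contDiffOn_sqrtLyap.continuousOn

/-- `-log s ≤ 1/s` for `0 < s`. [folklore] -/
theorem neg_log_le_inv {s : ℝ} (hs : 0 < s) : -Real.log s ≤ 1 / s := by
  have h := Real.log_le_sub_one_of_pos (inv_pos.2 hs)
  rw [Real.log_inv] at h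
  rw [one_div]
  linarith

/-- `(log s)² ≤ 4/s` for `0 < s ≤ 1` (from `-log s = 2 log(1/√s) ≤ 2/√s`). [folklore] -/
theorem sq_log_le {s : ℝ} (hs : 0 < s) (hs1 : s ≤ 1) : Real.log s ^ 2 ≤ 4 / s := by
  have hsq : 0 < Real.sqrt s := Real.sqrt_pos.2 hs
  have h1 := Real.log_le_sub_one_of_pos (inv_pos.2 hsq)
  rw [Real.log_inv, Real.log_sqrt hs.le] at h1
  have hL0 : 0 ≤ -Real.log s := by
    rw [neg_nonneg]; exact Real.log_nonpos hs.le hs1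
  have hle : -Real.log s ≤ 2 * (Real.sqrt s)⁻¹ := by
    have : 0 ≤ (Real.sqrt s)⁻¹ := (inv_pos.2 hsq).le
    linarith
  have hsq2 : (2 * (Real.sqrt s)⁻¹) ^ 2 = 4 / s := by
    rw [mul_pow, inv_pow, Real.sq_sqrt hs.le]; norm_num; rw [div_eq_mul_inv]
  calc Real.log s ^ 2 = (-Real.log s) ^ 2 := by ring
    _ ≤ (2 * (Real.sqrt s)⁻¹) ^ 2 := pow_le_pow_left₀ hL0 hle 2
    _ = 4 / s := hsq2

/-- **The coercive Lyapunov inequality** for `V = (1 - log sin(·/2))^{1/2}` and `0 < κ ≤ 4`: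
`Λ₁ V = (κ/2) V'' + cot(y/2) V' + V ≤ C_κ := (40 + κ + 10000/κ)/32` on `(0, 2π)`. With
`s = sin(y/2)`, `W = 1 - log s = V²`: `32 s² V³ Λ₁ V = 2κ W - κ cos²(y/2) - 8 cos²(y/2) W + 32 s² W²`,
and `-κ cos² = -κ + κ s²` supplies the coercive term `-κ` against which
`8 W + 32 W² ≤ 40 + 200/s ≤ 40 + κ/s² + 10000/κ` (from `-log s ≤ 1/s`, `log² s ≤ 4/s`) is
absorbed. This is where both `κ ≤ 4` (to discard `(2κ - 8) W`) and `κ > 0` enter. [folklore] -/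
theorem expGenerator_sqrtLyap_le (hκ0 : 0 < κ) (hκ : κ ≤ 4) {y : ℝ} (hy : y ∈ Ioo 0 (2 * Real.pi)) :
    expGenerator κ 1 (fun y ↦ Real.sqrt (1 - Real.log (Real.sin (y / 2)))) y ≤
      (40 + (κ : ℝ) + 10000 / κ) / 32 := by
  have hκr : (0 : ℝ) < κ := by exact_mod_cast hκ0
  have hκ4 : (κ : ℝ) ≤ 4 := by exact_mod_cast hκ
  rw [expGenerator_apply, iteratedDeriv_two_sqrtLyap hy, deriv_sqrtLyap hy, one_mul,
    Real.cot_eq_cos_div_sin]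
  set s := Real.sin (y / 2) with hsdef
  set co := Real.cos (y / 2) with hcodef
  set W := 1 - Real.log s with hWdef
  set r := Real.sqrt W with hrdef
  have hs : 0 < s := sin_half_pos hy
  have hs1 : s ≤ 1 := Real.sin_le_one _
  have hW1 : 1 ≤ W := one_le_oneSubLogSinHalf y
  have hr : 0 < r := sqrtLyap_pos y
  have hr1 : 1 ≤ r := one_le_sqrtLyap y
  have hr2 : r ^ 2 = W := Real.sq_sqrt (by linarith)
  have hco : co ^ 2 = 1 - s ^ 2 := by rw [hcodef, hsdef, Real.cos_sq']
  have hL1 : -Real.log s ≤ 1 / s := neg_log_le_inv hs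
  have hL2 : Real.log s ^ 2 ≤ 4 / s := sq_log_le hs hs1
  have hsne : s ≠ 0 := hs.ne'
  have hrne : r ≠ 0 := hr.ne'
  -- the generator as one fraction
  have hexpr : (κ : ℝ) / 2 * ((-(1 / 4) * (-(s ^ 2)⁻¹ * (1 / 2)) * r -
      -(1 / 4) * (co / s) * (-(1 / 4) * (co / s) / r)) / r ^ 2) +
      co / s * (-(1 / 4) * (co / s) / r) + r =
      (2 * κ * W - κ * co ^ 2 - 8 * co ^ 2 * W + 32 * s ^ 2 * W ^ 2) / (32 * s ^ 2 * r ^ 3) := by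
    have hr3 : r ^ 3 = r * W := by rw [← hr2]; ring
    have hr4 : W ^ 2 = r ^ 4 := by rw [← hr2]; ring
    rw [hr3, hr4, ← hr2]
    field_simp
    ring
  rw [hexpr, div_le_iff₀ (by positivity)]
  -- reduce to the key inequality `κ + 8W + 32W² ≤ κ/s² + (40 + κ + 10000/κ)`, times `s²`
  have hkey : s ^ 2 * (8 * W + 32 * W ^ 2) ≤ 40 * s ^ 2 + 10000 / κ * s ^ 2 + κ := by
    -- `8W + 32W² ≤ 40 + 200/s`
    have hW : W = 1 + -Real.log s := by rw [hWdef]; ring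
    have h72 : 8 * W + 32 * W ^ 2 ≤ 40 + 200 / s := by
      have hexp : 8 * W + 32 * W ^ 2 = 40 + 72 * (-Real.log s) + 32 * Real.log s ^ 2 := by rw [hW]; ring
      rw [hexp]
      have h1 : 72 * (-Real.log s) ≤ 72 * (1 / s) := by linarith
      have h2 : 32 * Real.log s ^ 2 ≤ 32 * (4 / s) := by linarith
      have h3 : 72 * (1 / s) + 32 * (4 / s) = 200 / s := by ring
      linarith
    -- `200 s ≤ κ + (10000/κ) s²` (AM–GM)
    have hamgm : 200 * s ≤ κ + 10000 / κ * s ^ 2 := by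
      have h := sq_nonneg (100 / κ * s - 1)
      have hk : (100 / κ * s - 1) ^ 2 * κ = 10000 / κ * s ^ 2 - 200 * s + κ := by
        field_simp
        try ring
      nlinarith [h, hk, mul_nonneg h hκr.le]
    have hs2 : 0 < s ^ 2 := by positivity
    calc s ^ 2 * (8 * W + 32 * W ^ 2) ≤ s ^ 2 * (40 + 200 / s) :=
          mul_le_mul_of_nonneg_left h72 hs2.le
      _ = 40 * s ^ 2 + 200 * s := by field_simp
      _ ≤ 40 * s ^ 2 + (κ + 10000 / κ * s ^ 2) := by linarith
      _ = 40 * s ^ 2 + 10000 / κ * s ^ 2 + κ := by ring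
  -- discard `(2κ - 8) W ≤ 0` and use `r³ ≥ 1`
  have hW0 : 0 ≤ W := by linarith
  have hdrop : 2 * (κ : ℝ) * W - 8 * W ≤ 0 := by nlinarith
  have hr3 : 1 ≤ r ^ 3 := one_le_pow₀ hr1
  have hC0 : 0 ≤ (40 + (κ : ℝ) + 10000 / κ) / 32 := by positivity
  have hrhs : (40 + (κ : ℝ) + 10000 / κ) / 32 * (32 * s ^ 2 * 1) ≤
      (40 + (κ : ℝ) + 10000 / κ) / 32 * (32 * s ^ 2 * r ^ 3) := by
    gcongr
  calc 2 * (κ : ℝ) * W - κ * co ^ 2 - 8 * co ^ 2 * W + 32 * s ^ 2 * W ^ 2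
      = (2 * κ * W - 8 * W) + (-κ + κ * s ^ 2) + s ^ 2 * (8 * W + 32 * W ^ 2) := by
        rw [hco]; ring
    _ ≤ 0 + (-κ + κ * s ^ 2) + (40 * s ^ 2 + 10000 / κ * s ^ 2 + κ) := by gcongr
    _ = (40 + (κ : ℝ) + 10000 / κ) / 32 * (32 * s ^ 2 * 1) := by ring
    _ ≤ (40 + (κ : ℝ) + 10000 / κ) / 32 * (32 * s ^ 2 * r ^ 3) := hrhs

/-- The Lyapunov constant is nonnegative. [folklore] -/
theorem lyapConst_nonneg (κ : ℝ≥0) : 0 ≤ (40 + (κ : ℝ) + 10000 / κ) / 32 := by positivity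

/-- **Sublevel sets of `V` are compactly contained in `(0, 2π)`**: for every `R` there is `ε > 0`
with `{y ∈ (0, 2π) | V(y) ≤ R} ⊆ [ε, 2π - ε]` (`V(y) ≤ R` forces `sin(y/2) ≥ e^{1 - R²}`).
[folklore] -/
theorem exists_sqrtLyap_sublevel_subset_Icc (R : ℝ) : ∃ ε : ℝ, 0 < ε ∧
    ∀ y ∈ Ioo 0 (2 * Real.pi), Real.sqrt (1 - Real.log (Real.sin (y / 2))) ≤ R →
      y ∈ Icc ε (2 * Real.pi - ε) := by
  -- `η = e^{1 - R²} > 0`; if `sin(y/2) ≥ η` and `y/2 ∈ (0, π)` then `y/2 ∈ [arcsin η, π - arcsin η]`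
  set η := Real.exp (1 - R ^ 2) with hη
  have hη0 : 0 < η := Real.exp_pos _
  set ε := 2 * Real.arcsin (min η 1) with hε
  have hm0 : 0 < min η 1 := lt_min hη0 one_pos
  have hm1 : min η 1 ≤ 1 := min_le_right _ _
  have harc0 : 0 < Real.arcsin (min η 1) := Real.arcsin_pos.2 hm0
  refine ⟨ε, by positivity, fun y hy hV ↦ ?_⟩
  have hs := sin_half_pos hy
  -- `sin(y/2) ≥ η`
  have hsin : min η 1 ≤ Real.sin (y / 2) := by
    refine (min_le_left _ _).trans ?_
    by_contra hlt
    rw [not_le] at hlt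
    -- then `1 - log sin(y/2) > R²`, contradicting `V ≤ R`
    have hlog : Real.log (Real.sin (y / 2)) < 1 - R ^ 2 := by
      have := Real.log_lt_log hs hlt
      rwa [hη, Real.log_exp] at this
    have hgt : R ^ 2 < 1 - Real.log (Real.sin (y / 2)) := by linarith
    have hR : R < Real.sqrt (1 - Real.log (Real.sin (y / 2))) := by
      rcases le_or_gt 0 R with hR0 | hR0
      · exact Real.lt_sqrt hR0 |>.2 hgt
      · exact hR0.trans_le (Real.sqrt_nonneg _)
    linarith
  -- `arcsin (min η 1) ≤ y/2` and `y/2 ≤ π - arcsin (min η 1)`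
  have h1 : Real.arcsin (min η 1) ≤ y / 2 := by
    by_contra hlt
    rw [not_le] at hlt
    -- `sin` increasing on `[-π/2, π/2]`
    have := Real.sin_lt_sin_of_lt_of_le_pi_div_two (by linarith [hy.1, Real.pi_pos])
      (Real.arcsin_le_pi_div_two _) hlt
    rw [Real.sin_arcsin (by linarith) hm1] at this
    linarith
  have h2 : y / 2 ≤ Real.pi - Real.arcsin (min η 1) := by
    by_contra hlt
    rw [not_le] at hlt
    have hlt' : Real.pi - y / 2 < Real.arcsin (min η 1) := by linarith
    have := Real.sin_lt_sin_of_lt_of_le_pi_div_two (by linarith [hy.2]) (Real.arcsin_le_pi_div_two _) hlt'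
    rw [Real.sin_pi_sub, Real.sin_arcsin (by linarith) hm1] at this
    linarith
  rw [hε]
  constructor <;> linarith

end Calculus

/-! ### The exponentially weighted Dynkin bound at the level exit times -/

/-- `∫₀ᵗ e^{μ s} ds = (e^{μ t} - 1)/μ` (`μ ≠ 0`). [folklore] -/
theorem integral_exp_mul_eq {μ : ℝ} (hμ : μ ≠ 0) (t : ℝ) :
    ∫ s in (0 : ℝ)..t, Real.exp (μ * s) = (Real.exp (μ * t) - 1) / μ := by
  rw [intervalIntegral.integral_comp_mul_left (fun v ↦ Real.exp v) hμ, integral_exp, mul_zero,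
    Real.exp_zero, smul_eq_mul]
  ring

/-- **`E[e^{μ(t∧σₙ)} F(Y_{t∧σₙ})] ≤ F(θ) + C (e^{μ t} - 1)/μ`** for `F ∈ C²(ℝ)` with `Λ_μ F ≤ C`
(`C ≥ 0`, `μ > 0`) on the level-`n` interval (start inside): the exponentially weighted generator
martingale of `RadialBesselSLE` (`integral_expClock_mul_eq`) with the drift bounded by
`𝟙_{s ≤ σₙ} e^{μ s} C ≤ e^{μ s} C`. Lawler (2005), Lemma 1.31 pattern. [cite: Lawler2005, §1.11 Lemma 1.31] -/
theorem integral_expClock_mul_le_of_expGenerator_le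
    (hθn : θ ∈ Ioo (2 * level n) (2 * Real.pi - 2 * level n))
    {F : ℝ → ℝ} (hF : ContDiff ℝ 2 F) {μ : ℝ} (hμ : 0 < μ) {C : ℝ} (hC : 0 ≤ C)
    (hgen : ∀ y ∈ Icc (2 * level n) (2 * Real.pi - 2 * level n), expGenerator κ μ F y ≤ C) (t : ℝ≥0) :
    ∫ ω, expClock κ n θ μ t ω * F (stoppedProcess (sleArgLevel κ n θ) (sleExitLevel κ n θ) t ω)
        ∂preWienerMeasure ≤ F θ + C * (Real.exp (μ * t) - 1) / μ := by
  haveI := isProbabilityMeasure_preWienerMeasure'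
  rw [integral_expClock_mul_eq hθn hF μ t]
  have hle : ∀ ω, (∫ s in (0 : ℝ)..t, genDrift κ n θ μ F s.toNNReal ω) ≤ C * (Real.exp (μ * t) - 1) / μ := by
    intro ω
    have hcont : Continuous fun s : ℝ ↦ C * Real.exp (μ * s) :=
      continuous_const.mul (Real.continuous_exp.comp (continuous_const.mul continuous_id))
    have h := intervalIntegral.integral_mono_on t.coe_nonneg (intervalIntegrable_genDrift hθn hF μ ω 0 t)
      (hcont.intervalIntegrable _ _) fun s hs ↦ (show genDrift κ n θ μ F s.toNNReal ω ≤ C * Real.exp (μ * s) by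
        simp only [genDrift_apply, trunc_apply]
        split_ifs
        · rw [Real.coe_toNNReal _ hs.1, mul_comm C]
          exact mul_le_mul_of_nonneg_left (hgen _ (stoppedProcess_sleArgLevel_mem_Icc hθn _ ω))
            (Real.exp_pos _).le
        · positivity)
    rw [intervalIntegral.integral_const_mul, integral_exp_mul_eq hμ.ne'] at h
    rw [mul_div_assoc]
    exact h
  have hmono := integral_mono (integrable_integral_genDrift hθn hF μ t)
    (integrable_const (C * (Real.exp (μ * t) - 1) / μ)) hle
  rw [integral_const, probReal_univ, one_smul] at hmono
  linarith

/-! ### The uniform moment bound for the maximal flow -/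

/-- **Uniform-in-time moment bound** (`0 < κ ≤ 4`, `θ ∈ (0, 2π)`, `V = (1 - log sin(·/2))^{1/2}`,
`C_κ = (40 + κ + 10000/κ)/32`): for the maximal radial Bessel flow `Y = arg` of SLE_κ,

  `∫⁻ V(Yₜ) dP ≤ V(θ) + C_κ`   for every `t ≥ 0`.

Proof: `Λ₁ V ≤ C_κ` (`expGenerator_sqrtLyap_le`), so at each level `n` (global `C²` version of `V`
near the level interval) `E[e^{t∧σₙ} V(Y_{t∧σₙ})] ≤ V(θ) + C_κ (eᵗ - 1)`; as `n → ∞`, `σₙ > t`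
eventually a.s. (`RadialBesselNonHitting`), and Fatou's lemma gives `eᵗ E[V(Yₜ)] ≤ V(θ) + C_κ(eᵗ - 1)`.
This is the drift condition of Meyn–Tweedie type behind the existence of the stationary law of the
SLE_κ(ρ) angle process (Miller–Sheffield (2017), Prop. 2.1). [cite: MillerSheffield2013, Prop. 2.1] -/
theorem lintegral_sqrtLyap_sleArg_le (hκ0 : 0 < κ) (hκ : κ ≤ 4) (hθ : θ ∈ Ioo 0 (2 * Real.pi))
    (t : ℝ≥0) :
    ∫⁻ ω, ENNReal.ofReal (Real.sqrt (1 - Real.log (Real.sin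
        (arg (sleDriving κ) (continuous_sleDriving' κ) θ t ω / 2)))) ∂preWienerMeasure ≤
      ENNReal.ofReal (Real.sqrt (1 - Real.log (Real.sin (θ / 2))) + (40 + (κ : ℝ) + 10000 / κ) / 32) := by
  haveI := isProbabilityMeasure_preWienerMeasure'
  set V : ℝ → ℝ := fun y ↦ Real.sqrt (1 - Real.log (Real.sin (y / 2))) with hVdef
  set C := (40 + (κ : ℝ) + 10000 / κ) / 32 with hCdef
  have hC0 : 0 ≤ C := lyapConst_nonneg κ
  obtain ⟨N₀, hN₀⟩ := eventually_mem_Ioo_level hθ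
  -- the observables `gₙ = e^{t∧σₙ} V(Y_{t∧σₙ})`
  set g : ℕ → (ℝ≥0 → ℝ) → ℝ := fun n ω ↦ expClock κ n θ 1 t ω *
    V (stoppedProcess (sleArgLevel κ n θ) (sleExitLevel κ n θ) t ω) with hgdef
  have hg0 : ∀ n ω, 0 ≤ g n ω := fun n ω ↦ mul_nonneg (expClock_pos 1 t ω).le (sqrtLyap_nonneg _)
  -- expectation bound and measurability at every level `n ≥ N₀`
  have hlevel : ∀ n, N₀ ≤ n → Integrable (g n) preWienerMeasure ∧
      ∫ ω, g n ω ∂preWienerMeasure ≤ V θ + C * (Real.exp (1 * t) - 1) / 1 := by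
    intro n hn
    have hθn := hN₀ n hn
    obtain ⟨F, hF, hFeq⟩ := exists_contDiff_eventuallyEq contDiffOn_sqrtLyap (level_pos n) (level_lt_pi n)
    have hFval : ∀ y ∈ Icc (2 * level n) (2 * Real.pi - 2 * level n), F y = V y := fun y hy ↦
      (hFeq y (Icc_level_subset_Ioo_level n hy)).eq_of_nhds
    have hFgen : ∀ y ∈ Icc (2 * level n) (2 * Real.pi - 2 * level n), expGenerator κ 1 F y ≤ C :=
      fun y hy ↦ by
        rw [expGenerator_congr (hFeq y (Icc_level_subset_Ioo_level n hy))]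
        exact expGenerator_sqrtLyap_le hκ0 hκ (Icc_level_subset_Ioo n hy)
    have hgF : g n = fun ω ↦ expClock κ n θ 1 t ω *
        F (stoppedProcess (sleArgLevel κ n θ) (sleExitLevel κ n θ) t ω) := by
      funext ω
      simp only [hgdef]
      rw [hFval _ (stoppedProcess_sleArgLevel_mem_Icc hθn t ω)]
    rw [hgF]
    refine ⟨integrable_expClock_mul hθn hF 1 t, ?_⟩
    have h := integral_expClock_mul_le_of_expGenerator_le hθn hF one_pos hC0 hFgen t
    rwa [hFval θ ⟨hθn.1.le, hθn.2.le⟩] at h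
  -- a.e. the observables are eventually `eᵗ V(Yₜ)`
  have hae : ∀ᵐ ω ∂preWienerMeasure, Tendsto (fun n ↦ ENNReal.ofReal (g n ω)) atTop
      (𝓝 (ENNReal.ofReal (Real.exp t * V (arg (sleDriving κ) (continuous_sleDriving' κ) θ t ω)))) := by
    filter_upwards [ae_eventually_lt_sleExitLevel hκ hθ t] with ω hω
    refine (tendsto_const_nhds (x := ENNReal.ofReal (Real.exp t *
      V (arg (sleDriving κ) (continuous_sleDriving' κ) θ t ω)))).congr' ?_
    filter_upwards [hω] with n hn
    simp only [hgdef]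
    rw [expClock_apply, untopA_min_of_le hn.le, one_mul, stoppedProcess_eq_of_le hn.le]
    congr 3
    exact arg_eq_argLevel (continuous_sleDriving' κ) hn.le
  -- Fatou
  have hmeas : ∀ n, AEMeasurable (fun ω ↦ ENNReal.ofReal (g n ω)) preWienerMeasure := by
    intro n
    by_cases hn : N₀ ≤ n
    · exact ((hlevel n hn).1.aemeasurable).ennreal_ofReal
    · -- irrelevant levels: still measurable (product of measurable functions)
      refine (Measurable.aemeasurable ?_).ennreal_ofReal
      exact ((measurable_expClock 1 t).mono (brownianFiltration.le t) le_rfl).mul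
        (measurable_sqrtLyap.comp ((stronglyAdapted_stoppedProcess_sleArgLevel κ n θ
          (isStoppingTime_sleExitLevel κ n θ) t).measurable.mono (brownianFiltration.le t) le_rfl))
  have hfatou := lintegral_liminf_le' (μ := preWienerMeasure) (u := (atTop : Filter ℕ)) hmeas
  have hlim : ∫⁻ ω, ENNReal.ofReal (Real.exp t * V (arg (sleDriving κ) (continuous_sleDriving' κ) θ t ω))
      ∂preWienerMeasure = ∫⁻ ω, liminf (fun n ↦ ENNReal.ofReal (g n ω)) atTop ∂preWienerMeasure :=
    lintegral_congr_ae (hae.mono fun ω hω ↦ hω.liminf_eq.symm)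
  have hbound : liminf (fun n ↦ ∫⁻ ω, ENNReal.ofReal (g n ω) ∂preWienerMeasure) atTop ≤
      ENNReal.ofReal (V θ + C * (Real.exp t - 1)) := by
    refine liminf_le_of_frequently_le' (Eventually.frequently (eventually_atTop.2 ⟨N₀, fun n hn ↦ ?_⟩))
    obtain ⟨hint, hE⟩ := hlevel n hn
    rw [← ofReal_integral_eq_lintegral_ofReal hint (Eventually.of_forall (hg0 n))]
    refine ENNReal.ofReal_le_ofReal ?_
    simpa using hE
  have hmain : ∫⁻ ω, ENNReal.ofReal (Real.exp t * V (arg (sleDriving κ) (continuous_sleDriving' κ) θ t ω))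
      ∂preWienerMeasure ≤ ENNReal.ofReal (V θ + C * (Real.exp t - 1)) :=
    hlim.trans_le (hfatou.trans hbound)
  -- divide by `eᵗ`
  have hexp : 0 < Real.exp t := Real.exp_pos _
  have hsplit : ∀ ω, ENNReal.ofReal (Real.exp t * V (arg (sleDriving κ) (continuous_sleDriving' κ) θ t ω)) =
      ENNReal.ofReal (Real.exp t) * ENNReal.ofReal (V (arg (sleDriving κ) (continuous_sleDriving' κ) θ t ω)) :=
    fun ω ↦ ENNReal.ofReal_mul hexp.le
  simp_rw [hsplit] at hmain
  rw [lintegral_const_mul' _ _ ENNReal.ofReal_ne_top] at hmain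
  have hkey : ∫⁻ ω, ENNReal.ofReal (V (arg (sleDriving κ) (continuous_sleDriving' κ) θ t ω)) ∂preWienerMeasure ≤
      ENNReal.ofReal (Real.exp (-t) * (V θ + C * (Real.exp t - 1))) := by
    have h1 : ENNReal.ofReal (Real.exp (-t)) * (ENNReal.ofReal (Real.exp t) *
        ∫⁻ ω, ENNReal.ofReal (V (arg (sleDriving κ) (continuous_sleDriving' κ) θ t ω)) ∂preWienerMeasure) ≤
        ENNReal.ofReal (Real.exp (-t)) * ENNReal.ofReal (V θ + C * (Real.exp t - 1)) :=
      mul_le_mul_right hmain _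
    rw [← mul_assoc, ← ENNReal.ofReal_mul (Real.exp_pos _).le, ← Real.exp_add, neg_add_cancel,
      Real.exp_zero, ENNReal.ofReal_one, one_mul, ← ENNReal.ofReal_mul (Real.exp_pos _).le] at h1
    exact h1
  refine hkey.trans (ENNReal.ofReal_le_ofReal ?_)
  -- `e^{-t}(V θ + C(eᵗ - 1)) = e^{-t} V θ + C (1 - e^{-t}) ≤ V θ + C`
  have hVθ : 0 ≤ V θ := sqrtLyap_nonneg θ
  have he1 : Real.exp (-(t : ℝ)) ≤ 1 := by
    rw [Real.exp_le_one_iff]; exact neg_nonpos.2 t.coe_nonneg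
  have he0 : 0 < Real.exp (-(t : ℝ)) := Real.exp_pos _
  have hprod : Real.exp (-(t : ℝ)) * Real.exp t = 1 := by rw [← Real.exp_add, neg_add_cancel, Real.exp_zero]
  nlinarith [mul_le_mul_of_nonneg_right he1 hVθ, hprod, mul_nonneg he0.le hC0]

end RadialLoewner

end Literature.Probability.RandomPlanarGeometry
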